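import Summits.ResolutionOfSingularities.ResolutionOfSingularities.Theorems.EquisingularLiftEquisingularLiftNatHorizontalForced
import Summits.ResolutionOfSingularities.ResolutionOfSingularities.Theorems.EquisingularLiftEquisingularLiftNatUltOfNat
import HarnessLib

/-!
# [OURS · L1 W4.5(b) · EL♮] ULT WITH FLATNESS: EL♮ ⇒ the first touch at a non-regular point is reached by a HORIZONTAL
# avoiding chain and the touching centre is GLOBALLY `O`-FLAT — any `n`
# (crux `EquisingularLiftNat` = stmt-ResolutionOfSingularities-20038; object T-ULT-FLAT)

HONEST FRAMING. OURS (cell res-hironaka, crux chain w45b, slot W4.5(b)); NOT a statement of any manuscript; replaces the role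
of NOTHING in the manuscript; AI-written, AI review is weaker than expert review. Helper `--supports
stmt-ResolutionOfSingularities-20038 --as helper` (any-`n` object). Kernel input for the DISPROVER TARGET OF RECORD for
stmt-20038 AS TYPED (director-resolution RULING 2026-08-27T06:57:05Z (1): `n = 5`, `H = V(G)`, `Sing H = S` a smooth
BMY-violating surface; hand res-D-brk-4 K5-BMY, STEP 0 file HOME/D/res-D-brk-4/K5-BMY/STEP0-first-touch-n5.md): the typed
necessary condition `ULTAt` (res-L1-type-o1; `ult_of_equisingularLiftNat`, p505870) records horizontality of the touching
centre AT THE TOUCHING POINT only and nothing about the avoiding prefix. With T-HORIZ-FORCED (p509967: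
`flat_subschemeι_comp_of_horizontal`) the same first-touch induction yields MORE, for free:

* `exists_flat_touching_centre_of_natChain` — general base `q : P → Spec O` (`O` a DVR, `P` integral Noetherian, generic point
  off the special fibre, `Y` inside the special fibre and off its maximal points), `(P′, σ, S′)` in the item's E1-closure with
  irreducible last special fibre and regular `V(closure S′)`, `x ∈ Y` a point with a non-regular point of `V(closure Y)` over it:
  there is a stage `(X₀, σ₀, Y₀)` reached from `(P, 𝟙, Y)` by `x`-AVOIDING steps ALL OF WHOSE CENTRES ARE `O`-FLAT (horizontal
  avoiding closure) and a regular centre `C₀` on `X₀`, `O`-FLAT (`V(C₀) → Spec O` flat), through a point `x₀ ↦ x` with a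
  generisation inside `supp C₀` off the special fibre, E1, non-generic. Motive: invariants ∧ (GOAL ∨ two maximal points ∨
  (horizontally `x`-avoiding ∧ a non-regular point over `x` survives)); at every step either some special fibre is reducible
  (persists to the end, contradiction) or both are irreducible and then the centre is `O`-flat (p504712 + p509967).
* `ultFlat_of_equisingularLiftNat` — THE OBJECT for the item's ambient `ℙⁿ_O`: `EquisingularLiftNat p →` (binders of `ULT p`
  minus the unused «`h` not closed») the `ULTAt` body WITH the two flatness clauses inserted (avoiding steps: `Flat
  (C.subschemeι ≫ σ′ ≫ q)`; touching centre: `Flat (C.subschemeι ≫ σ ≫ q)`). A K5-BMY-type refutation may therefore assume a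
  HORIZONTAL prefix and an `O`-FLAT touching centre.
* `not_equisingularLiftNat_of_not_ultFlat` — the disprover's exit in this currency.

References: tree files `…NatUltOfNat` (p505870), `…NatHorizontalForced` (p509967), `…NatVerticalCentre` (p504712),
`…NatSpecialFibreMaxPoints` (p503337), `…NatFirstTouch` (p500156), `…CampaignW45bULT` (o1); GW I Prop. 13.91 [GortzWedhorn2020];
Hartshorne III Prop. 9.7 [Hartshorne1977].
-/

set_option linter.dupNamespace false -- mandated namespace `Summit.<Summit>.<Problem>` of this single-conjunct summit
set_option linter.overlappingInstances false -- item signatures carry `[IsDomain O] [IsDiscreteValuationRing O]`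

open CategoryTheory AlgebraicGeometry TopologicalSpace Topology
open Literature.AlgebraicGeometry.Resolution
open AlgebraicGeometry.Scheme.IdealSheafData
open Summit.ResolutionOfSingularities.ResolutionOfSingularities.Theses.EquisingularLift.Split
open Summit.ResolutionOfSingularities.ResolutionOfSingularities.Cruxes.EquisingularLift.StrataSplit
open Summit.ResolutionOfSingularities.ResolutionOfSingularities.Theorems.EquisingularLift

namespace Summit.ResolutionOfSingularities.ResolutionOfSingularities.Cruxes.EquisingularLiftNat.Sections

/-! ## FIRST TOUCH with an `O`-FLAT centre after a HORIZONTAL avoiding chain (general base) -/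

/-- **FIRST TOUCH with an `O`-FLAT centre after a HORIZONTAL avoiding chain (general base).** Setting of
`exists_horizontal_touching_centre_of_natChain` (p505870) over a DVR `O`. Every non-regular point over `x ∈ Y` of `V(closure Y)`
is touched, after an `x`-avoiding chain ALL OF WHOSE CENTRES ARE `O`-FLAT, by a regular `O`-FLAT centre `C₀ ∋ x₀ ↦ x` (E1,
non-generic) having a generisation `c ⤳ x₀` inside `supp C₀` off the special fibre. [folklore; GW I Prop. 13.91 (3), Krull,
Hartshorne III 9.7] -/
theorem exists_flat_touching_centre_of_natChain {O : Type} [CommRing O] [IsDomain O] [IsDiscreteValuationRing O]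
    {P : AlgebraicGeometry.Scheme.{0}} [AlgebraicGeometry.IsIntegral P] [AlgebraicGeometry.IsLocallyNoetherian P]
    [CompactSpace P] (q : P ⟶ AlgebraicGeometry.Spec (.of O)) (Y : Set P) {P' : AlgebraicGeometry.Scheme.{0}}
    (σ : P' ⟶ P) (S' : Set P')
    (hch : (∀ Q : (∀ X' : AlgebraicGeometry.Scheme.{0}, (X' ⟶ P) → Set X' → Prop), Q P (CategoryTheory.CategoryStruct.id _) Y → (∀ (X' X'' : AlgebraicGeometry.Scheme.{0}) (σ' : X' ⟶ P) (Y' : Set X') (C : X'.IdealSheafData) (τ : X'' ⟶ X'), Q X' σ' Y' → Literature.AlgebraicGeometry.Resolution.IsBlowup τ C → Literature.AlgebraicGeometry.Resolution.Scheme.IsRegular C.subscheme → σ' '' (C.support : Set X') ⊆ {x | ¬ IsGenericPoint x Y} → (C.support : Set X') ∩ (CategoryTheory.CategoryStruct.comp σ' q) ⁻¹' {IsLocalRing.closedPoint O} ⊆ Y' → Q X'' (CategoryTheory.CategoryStruct.comp τ σ') (closure (τ ⁻¹' (Y' \ (C.support : Set X'))))) → Q P' σ S'))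
    (hirr : IsIrreducible ((CategoryTheory.CategoryStruct.comp σ q) ⁻¹' {IsLocalRing.closedPoint O}))
    (hreg : Literature.AlgebraicGeometry.Resolution.Scheme.IsRegular (AlgebraicGeometry.Scheme.IdealSheafData.vanishingIdeal (⟨closure S', isClosed_closure⟩ : TopologicalSpace.Closeds P')).subscheme)
    (hgenP : ∀ ξ : P, IsGenericPoint ξ (Set.univ : Set P) → ξ ∉ q ⁻¹' {IsLocalRing.closedPoint O})
    (hYF : Y ⊆ q ⁻¹' {IsLocalRing.closedPoint O})
    (hNM : ∀ w : P, (w ∈ q ⁻¹' {IsLocalRing.closedPoint O} ∧ ∀ y ∈ q ⁻¹' {IsLocalRing.closedPoint O}, y ⤳ w → y = w) →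
      w ∉ closure Y)
    {x : P} (hxY : x ∈ Y) (hx : (∃ w : ↥(AlgebraicGeometry.Scheme.IdealSheafData.vanishingIdeal (⟨closure Y, isClosed_closure⟩ : TopologicalSpace.Closeds P)).subscheme, (AlgebraicGeometry.Scheme.IdealSheafData.vanishingIdeal (⟨closure Y, isClosed_closure⟩ : TopologicalSpace.Closeds P)).subschemeι w = x ∧ ¬ IsRegularLocalRing ((AlgebraicGeometry.Scheme.IdealSheafData.vanishingIdeal (⟨closure Y, isClosed_closure⟩ : TopologicalSpace.Closeds P)).subscheme.presheaf.stalk w))) :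
    ∃ (X₀ : AlgebraicGeometry.Scheme.{0}) (σ₀ : X₀ ⟶ P) (Y₀ : Set X₀), (∀ Q : (∀ X' : AlgebraicGeometry.Scheme.{0}, (X' ⟶ P) → Set X' → Prop), Q P (CategoryTheory.CategoryStruct.id _) Y → (∀ (X' X'' : AlgebraicGeometry.Scheme.{0}) (σ' : X' ⟶ P) (Y' : Set X') (C : X'.IdealSheafData) (τ : X'' ⟶ X'), Q X' σ' Y' → Literature.AlgebraicGeometry.Resolution.IsBlowup τ C → Literature.AlgebraicGeometry.Resolution.Scheme.IsRegular C.subscheme → AlgebraicGeometry.Flat (CategoryTheory.CategoryStruct.comp C.subschemeι (CategoryTheory.CategoryStruct.comp σ' q)) → σ' '' (C.support : Set X') ⊆ {x | ¬ IsGenericPoint x Y} → (C.support : Set X') ∩ (CategoryTheory.CategoryStruct.comp σ' q) ⁻¹' {IsLocalRing.closedPoint O} ⊆ Y' → x ∉ σ' '' (C.support : Set X') → Q X'' (CategoryTheory.CategoryStruct.comp τ σ') (closure (τ ⁻¹' (Y' \ (C.support : Set X'))))) → Q X₀ σ₀ Y₀) ∧ ∃ C₀ : X₀.IdealSheafData,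 Literature.AlgebraicGeometry.Resolution.Scheme.IsRegular C₀.subscheme ∧ AlgebraicGeometry.Flat (CategoryTheory.CategoryStruct.comp C₀.subschemeι (CategoryTheory.CategoryStruct.comp σ₀ q)) ∧ (∃ x₀ : X₀, x₀ ∈ (C₀.support : Set X₀) ∧ σ₀ x₀ = x ∧ ∃ c : X₀, c ∈ (C₀.support : Set X₀) ∧ c ∉ (CategoryTheory.CategoryStruct.comp σ₀ q) ⁻¹' {IsLocalRing.closedPoint O} ∧ c ⤳ x₀) ∧ (C₀.support : Set X₀) ∩ (CategoryTheory.CategoryStruct.comp σ₀ q) ⁻¹' {IsLocalRing.closedPoint O} ⊆ Y₀ ∧ σ₀ '' (C₀.support : Set X₀) ⊆ {x | ¬ IsGenericPoint x Y} := by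
  -- local abbreviations
  let F : ∀ X' : Scheme.{0}, (X' ⟶ P) → Set X' := fun X' σ' =>
    (CategoryTheory.CategoryStruct.comp σ' q) ⁻¹' {IsLocalRing.closedPoint O}
  let MP : ∀ X' : Scheme.{0}, Set X' → X' → Prop := fun X' F w => w ∈ F ∧ ∀ y ∈ F, y ⤳ w → y = w
  let RED : ∀ X' : Scheme.{0}, (X' ⟶ P) → Prop := fun X' σ' =>
    ∃ w₁ w₂ : X', MP X' (F X' σ') w₁ ∧ MP X' (F X' σ') w₂ ∧ w₁ ≠ w₂
  let NM : ∀ X' : Scheme.{0}, (X' ⟶ P) → Set X' → Prop := fun X' σ' Y' =>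
    ∀ w : X', MP X' (F X' σ') w → w ∉ closure Y'
  let HAV : ∀ X' : Scheme.{0}, (X' ⟶ P) → Set X' → Prop := fun X₀ σ₀ Y₀ =>
    (∀ Q : (∀ X' : AlgebraicGeometry.Scheme.{0}, (X' ⟶ P) → Set X' → Prop), Q P (CategoryTheory.CategoryStruct.id _) Y → (∀ (X' X'' : AlgebraicGeometry.Scheme.{0}) (σ' : X' ⟶ P) (Y' : Set X') (C : X'.IdealSheafData) (τ : X'' ⟶ X'), Q X' σ' Y' → Literature.AlgebraicGeometry.Resolution.IsBlowup τ C → Literature.AlgebraicGeometry.Resolution.Scheme.IsRegular C.subscheme → AlgebraicGeometry.Flat (CategoryTheory.CategoryStruct.comp C.subschemeι (CategoryTheory.CategoryStruct.comp σ' q)) → σ' '' (C.support : Set X') ⊆ {x | ¬ IsGenericPoint x Y} → (C.support : Set X') ∩ (CategoryTheory.CategoryStruct.comp σ' q) ⁻¹' {IsLocalRing.closedPoint O} ⊆ Y' → x ∉ σ' '' (C.support : Set X') → Q X'' (CategoryTheory.CategoryStruct.comp τ σ') (closure (τ ⁻¹' (Y' \ (C.support : Set X'))))) → Q X₀ σ₀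 Y₀)
  let NR : ∀ X' : Scheme.{0}, (X' ⟶ P) → Set X' → Prop := fun X' σ' Y' =>
    ∃ x' : X', x' ∈ Y' ∧ σ' x' = x ∧ (∃ w : ↥(AlgebraicGeometry.Scheme.IdealSheafData.vanishingIdeal (⟨closure Y', isClosed_closure⟩ : TopologicalSpace.Closeds X')).subscheme, (AlgebraicGeometry.Scheme.IdealSheafData.vanishingIdeal (⟨closure Y', isClosed_closure⟩ : TopologicalSpace.Closeds X')).subschemeι w = x' ∧ ¬ IsRegularLocalRing ((AlgebraicGeometry.Scheme.IdealSheafData.vanishingIdeal (⟨closure Y', isClosed_closure⟩ : TopologicalSpace.Closeds X')).subscheme.presheaf.stalk w))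
  have hFcl : ∀ (X' : Scheme.{0}) (σ' : X' ⟶ P), IsClosed (F X' σ') := fun X' σ' =>
    (IsLocalRing.isClosed_singleton_closedPoint O).preimage (CategoryTheory.CategoryStruct.comp σ' q).base.hom.continuous
  have hFstep : ∀ (X' X'' : Scheme.{0}) (σ' : X' ⟶ P) (τ : X'' ⟶ X'),
      F X'' (CategoryTheory.CategoryStruct.comp τ σ') = τ ⁻¹' F X' σ' := by
    intro X' X'' σ' τ
    ext v
    simp only [F, Set.mem_preimage, Scheme.Hom.comp_apply]
  -- run the E1-closure
  have key := hch (fun X' σ' Y' => ((IsLocallyNoetherian X' ∧ CompactSpace X') ∧ IsIntegral X' ∧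
      (∀ ξ : X', IsGenericPoint ξ (Set.univ : Set X') → ξ ∉ F X' σ') ∧ (F X' σ').Nonempty ∧ Y' ⊆ F X' σ' ∧
      NM X' σ' Y') ∧
      ((∃ (X₀ : AlgebraicGeometry.Scheme.{0}) (σ₀ : X₀ ⟶ P) (Y₀ : Set X₀), (∀ Q : (∀ X' : AlgebraicGeometry.Scheme.{0}, (X' ⟶ P) → Set X' → Prop), Q P (CategoryTheory.CategoryStruct.id _) Y → (∀ (X' X'' : AlgebraicGeometry.Scheme.{0}) (σ' : X' ⟶ P) (Y' : Set X') (C : X'.IdealSheafData) (τ : X'' ⟶ X'), Q X' σ' Y' → Literature.AlgebraicGeometry.Resolution.IsBlowup τ C → Literature.AlgebraicGeometry.Resolution.Scheme.IsRegular C.subscheme → AlgebraicGeometry.Flat (CategoryTheory.CategoryStruct.comp C.subschemeι (CategoryTheory.CategoryStruct.comp σ' q)) → σ' '' (C.support : Set X') ⊆ {x | ¬ IsGenericPoint x Y} → (C.support : Set X') ∩ (CategoryTheory.CategoryStruct.comp σ' q) ⁻¹' {IsLocalRing.closedPoint O} ⊆ Y' → x ∉ σ' '' (C.support : Set X') → Q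 X'' (CategoryTheory.CategoryStruct.comp τ σ') (closure (τ ⁻¹' (Y' \ (C.support : Set X'))))) → Q X₀ σ₀ Y₀) ∧ ∃ C₀ : X₀.IdealSheafData, Literature.AlgebraicGeometry.Resolution.Scheme.IsRegular C₀.subscheme ∧ AlgebraicGeometry.Flat (CategoryTheory.CategoryStruct.comp C₀.subschemeι (CategoryTheory.CategoryStruct.comp σ₀ q)) ∧ (∃ x₀ : X₀, x₀ ∈ (C₀.support : Set X₀) ∧ σ₀ x₀ = x ∧ ∃ c : X₀, c ∈ (C₀.support : Set X₀) ∧ c ∉ (CategoryTheory.CategoryStruct.comp σ₀ q) ⁻¹' {IsLocalRing.closedPoint O} ∧ c ⤳ x₀) ∧ (C₀.support : Set X₀) ∩ (CategoryTheory.CategoryStruct.comp σ₀ q) ⁻¹' {IsLocalRing.closedPoint O} ⊆ Y₀ ∧ σ₀ '' (C₀.support : Set X₀) ⊆ {x | ¬ IsGenericPoint x Y}) ∨ RED X' σ' ∨ (HAV X' σ' Y' ∧ NR X' σ' Y'))) ?_ ?_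
  · obtain ⟨-, hG | hred | ⟨-, x', -, -, w, -, hw⟩⟩ := key
    · exact hG
    · obtain ⟨w₁, w₂, hw₁, hw₂, hne⟩ := hred
      exact absurd (maxPt_unique_of_isIrreducible hirr (hFcl P' σ) hw₁ hw₂) hne
    · exact absurd (hreg w) hw
  · -- base
    refine ⟨⟨⟨inferInstance, inferInstance⟩, inferInstance, ?_, ?_, ?_, ?_⟩,
      Or.inr (Or.inr ⟨fun Q h0 _ => h0, x, hxY, by simp, hx⟩)⟩
    · simpa [F] using hgenP
    · exact ⟨x, by simpa [F] using hYF hxY⟩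
    · simpa [F] using hYF
    · simpa [NM, MP, F] using hNM
  · intro X' X'' σ' Y' C τ hQ hbl hC hgen hE1
    obtain ⟨⟨⟨hN', hc'⟩, hint, hgen', hne', hSF, hnm⟩, hQ⟩ := hQ
    haveI := hN'
    haveI := hc'
    haveI := hint
    haveI : IsProper τ := hbl.isProper
    haveI : IsLocallyNoetherian X'' := LocallyOfFiniteType.isLocallyNoetherian τ
    haveI : CompactSpace X'' := QuasiCompact.compactSpace_of_compactSpace τ
    haveI : AlgebraicGeometry.IsNoetherian X'' := AlgebraicGeometry.IsNoetherian.mk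
    have hF'' : F X'' (CategoryTheory.CategoryStruct.comp τ σ') = τ ⁻¹' F X' σ' := hFstep X' X'' σ' τ
    -- maximal points of the special fibre are off the centre
    have hNMC : ∀ w, MP X' (F X' σ') w → w ∉ (C.support : Set X') := fun w hw hwC =>
      hnm w hw (subset_closure (hE1 ⟨hwC, hw.1⟩))
    -- the centre is a genuine ideal sheaf
    have hC0 : C ≠ ⊥ := by
      rintro rfl
      obtain ⟨v, hv⟩ := hne'
      obtain ⟨m, hm, -⟩ := exists_maxPt_specializes (hFcl X' σ') hv
      apply hNMC m hm
      rw [Scheme.IdealSheafData.support_bot]; trivial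
    haveI : IsIntegral X'' := hbl.isIntegral hC0
    have hsurj : Function.Surjective τ := surjective_of_isBlowup hbl hC0
    -- persistence of the structural invariants
    have hgenX' : genericPoint X' ∉ F X' σ' := hgen' _ (genericPoint_spec X')
    have hgen'' : ∀ ξ : X'', IsGenericPoint ξ (Set.univ : Set X'') →
        ξ ∉ F X'' (CategoryTheory.CategoryStruct.comp τ σ') := by
      intro ξ hξ
      rw [hF'']
      have hτξ : IsGenericPoint (τ ξ) (Set.univ : Set X') := by
        have h1 := hξ.image τ.base.hom.continuous
        rwa [Set.image_univ, hsurj.range_eq, closure_univ] at h1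
      show τ ξ ∉ F X' σ'
      exact hgen' _ hτξ
    have hne'' : (F X'' (CategoryTheory.CategoryStruct.comp τ σ')).Nonempty := by
      obtain ⟨v, hv⟩ := hne'
      obtain ⟨m, hm, -⟩ := exists_maxPt_specializes (hFcl X' σ') hv
      obtain ⟨m'', hm'', -, -⟩ := exists_maxPt_preimage_of_step τ C hbl (F X' σ') hm (hNMC m hm)
      exact ⟨m'', by rw [hF'']; show τ m'' ∈ F X' σ'; rw [hm'']; exact hm.1⟩
    have hSF'' : closure (τ ⁻¹' (Y' \ (C.support : Set X'))) ⊆ F X'' (CategoryTheory.CategoryStruct.comp τ σ') := by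
      rw [hF'']
      exact closure_minimal (fun v ⟨hv, _⟩ => hSF hv) ((hFcl X' σ').preimage τ.base.hom.continuous)
    have hnm'' : NM X'' (CategoryTheory.CategoryStruct.comp τ σ') (closure (τ ⁻¹' (Y' \ (C.support : Set X')))) := by
      intro w hw
      rw [hF''] at hw
      exact maxPt_not_mem_strictTransform_of_step τ C hbl (F X' σ') (hFcl X' σ') Y' hSF hnm w hw
    have hredstep : RED X' σ' → RED X'' (CategoryTheory.CategoryStruct.comp τ σ') := by
      intro hred
      obtain ⟨v₁, v₂, hv₁, hv₂, hne⟩ := exists_two_maxPt_preimage_of_step τ C hbl (F X' σ') hNMC hred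
      refine ⟨v₁, v₂, ?_, ?_, hne⟩
      · rw [hF'']; exact hv₁
      · rw [hF'']; exact hv₂
    refine ⟨⟨⟨inferInstance, inferInstance⟩, inferInstance, hgen'', hne'', hSF'', hnm''⟩, ?_⟩
    rcases hQ with hG | hred | ⟨hav, x', hx'Y, hx'x, w, hw, hwreg⟩
    · exact Or.inl hG
    · exact Or.inr (Or.inl (hredstep hred))
    · by_cases hred : RED X' σ' ∨ RED X'' (CategoryTheory.CategoryStruct.comp τ σ')
      · rcases hred with h | h
        · exact Or.inr (Or.inl (hredstep h))
        · exact Or.inr (Or.inl h)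
      · -- both special fibres are irreducible: the centre is horizontal everywhere, hence `O`-flat
        push Not at hred
        obtain ⟨hred', hred''⟩ := hred
        have huniq' : ∀ w₁ w₂, MP X' (F X' σ') w₁ → MP X' (F X' σ') w₂ → w₁ = w₂ := by
          intro w₁ w₂ h₁ h₂; by_contra hne; exact hred' ⟨w₁, w₂, h₁, h₂, hne⟩
        have huniq'' : ∀ w₁ w₂, MP X'' (F X'' (CategoryTheory.CategoryStruct.comp τ σ')) w₁ →
            MP X'' (F X'' (CategoryTheory.CategoryStruct.comp τ σ')) w₂ → w₁ = w₂ := by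
          intro w₁ w₂ h₁ h₂; by_contra hne; exact hred'' ⟨w₁, w₂, h₁, h₂, hne⟩
        have hirr' : IsIrreducible (F X' σ') := isIrreducible_of_maxPt_unique (hFcl X' σ') hne' huniq'
        have hirr'' : IsIrreducible (τ ⁻¹' F X' σ') := by
          rw [← hF'']
          exact isIrreducible_of_maxPt_unique (hFcl X'' _) hne'' huniq''
        obtain ⟨ζ, hζ⟩ := QuasiSober.sober hirr' (hFcl X' σ')
        have hζmax : MP X' (F X' σ') ζ := ⟨hζ.mem, fun y hy hyζ => ((hζ.specializes hy).antisymm hyζ).eq.symm⟩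
        have hζC : ζ ∉ (C.support : Set X') := hNMC ζ hζmax
        have hhor : ∀ x₀ ∈ (C.support : Set X'), ∃ c ∈ (C.support : Set X'), c ∉ F X' σ' ∧ c ⤳ x₀ :=
          fun x₀ hx₀ => exists_horizontal_generization_of_isIrreducible τ C hbl hC0 (F X' σ') (hFcl X' σ') hgenX' hζ
            hζC hirr'' hx₀
        have hflat : AlgebraicGeometry.Flat (CategoryTheory.CategoryStruct.comp C.subschemeι
            (CategoryTheory.CategoryStruct.comp σ' q)) :=
          flat_subschemeι_comp_of_horizontal (CategoryTheory.CategoryStruct.comp σ' q) C hC hhor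
        by_cases hxc : x ∈ σ' '' (C.support : Set X')
        · -- FIRST TOUCH
          obtain ⟨x₀, hx₀, hx₀x⟩ := hxc
          obtain ⟨c, hc, hcF, hcx₀⟩ := hhor x₀ hx₀
          exact Or.inl ⟨X', σ', Y', hav, C, hC, hflat, ⟨x₀, hx₀, hx₀x, c, hc, hcF, hcx₀⟩, hE1, hgen⟩
        · -- the centre misses `x`: extend the horizontal avoiding chain, the non-regular point survives
          refine Or.inr (Or.inr ⟨fun Q h0 hs => hs X' X'' σ' Y' C τ (hav Q h0 hs) hbl hC hflat hgen hE1 hxc, ?_⟩)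
          have hx'C : x' ∉ (C.support : Set X') := fun h => hxc ⟨x', h, hx'x⟩
          obtain ⟨x'', hx'', hmem, z, hz, hzreg⟩ := nonregular_point_persists τ C hbl Y' hx'Y hx'C w hw hwreg
          refine ⟨x'', hmem, ?_, z, hz, hzreg⟩
          rw [Scheme.Hom.comp_apply, hx'', hx'x]

/-! ## THE OBJECT: `EquisingularLiftNat p` ⇒ ULT with flatness -/

/-- **[OURS · L1 W4.5(b)] `EquisingularLiftNat p` ⇒ ULT WITH FLATNESS.** If the item EL♮ holds at `p`, then for every instance
`(k, n, H, ι)` and every point `h` of `H` with non-regular local ring, for the `O, π` the item provides and every `φ, Y`: there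
are a stage `(P′, σ, S′)` in the inductive closure of `(ℙⁿ_O, 𝟙, Y)` under E1-steps with `O`-FLAT regular centres AVOIDING
`x := (ι ≫ Proj.map φ) h`, and an ideal sheaf `C` on `P′` with `V(C)` regular AND `V(C) → Spec O` FLAT, a point `x′ ∈ supp C`
over `x` with a generisation `c ∈ supp C` off the special fibre, `supp C ∩ (σ ≫ q)⁻¹{s₀} ⊆ closure S′` (E1) and `σ(supp C)`
off the generic points of `Y` — i.e. `ULTAt p k n H ι h` with the two flatness clauses inserted. Base facts for `ℙⁿ_O` as in
`ult_of_equisingularLiftNat` (p505870). [folklore] -/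
theorem ultFlat_of_equisingularLiftNat {p : ℕ}
    (hE : Summit.ResolutionOfSingularities.ResolutionOfSingularities.Theorems.EquisingularLiftNat p) :
    p.Prime → ∀ (k : Type) [Field k] [CharP k p] [IsAlgClosed k] (n : ℕ) (H : AlgebraicGeometry.Scheme.{0}) (ι : H ⟶ (Literature.AlgebraicGeometry.Motives.projectiveSpace n k).left), AlgebraicGeometry.IsClosedImmersion ι → AlgebraicGeometry.IsIntegral H → (∀ y : (Literature.AlgebraicGeometry.Motives.projectiveSpace n k).left, ∃ U : (Literature.AlgebraicGeometry.Motives.projectiveSpace n k).left.affineOpens, y ∈ (U : (Literature.AlgebraicGeometry.Motives.projectiveSpace n k).left.Opens) ∧ (ι.ker.ideal U).IsPrincipal) → ∀ (h : H), ¬ IsRegularLocalRing (H.presheaf.stalk h) → ∃ (O : Type) (_ : CommRing O) (_ : IsDomain O) (_ : IsDiscreteValuationRing O) (_ : CharZero O) (π : O →+* k), Function.Surjective π ∧ (letI := MvPolynomial.gradedAlgebra (σ := Fin (n + 1)) (R := O); letI := MvPolynomial.gradedAlgebra (σ := Fin (n + 1)) (R := k); ∀ (φ : MvPolynomial.homogeneousSubmodule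 (Fin (n + 1)) O →+*ᵍ MvPolynomial.homogeneousSubmodule (Fin (n + 1)) k) (hφ' : HomogeneousIdeal.irrelevant (MvPolynomial.homogeneousSubmodule (Fin (n + 1)) k) ≤ (HomogeneousIdeal.irrelevant (MvPolynomial.homogeneousSubmodule (Fin (n + 1)) O)).map φ), (∀ s, φ s = MvPolynomial.map π s) → ∀ Y : Set (AlgebraicGeometry.Proj (MvPolynomial.homogeneousSubmodule (Fin (n + 1)) O)), Y = Set.range (CategoryTheory.CategoryStruct.comp ι (AlgebraicGeometry.Proj.map φ hφ') : H ⟶ (AlgebraicGeometry.Proj (MvPolynomial.homogeneousSubmodule (Fin (n + 1)) O))) → ∃ (P' : AlgebraicGeometry.Scheme.{0}) (σ : P' ⟶ (AlgebraicGeometry.Proj (MvPolynomial.homogeneousSubmodule (Fin (n + 1)) O))) (S' : Set P'), (∀ Q : (∀ X' : AlgebraicGeometry.Scheme.{0}, (X' ⟶ (AlgebraicGeometry.Proj (MvPolynomial.homogeneousSubmodule (Fin (n + 1)) O))) → Set X' → Prop), Q (AlgebraicGeometry.Proj (MvPolynomial.homogeneousSubmodule (Fin (n + 1)) O)) (CategoryTheory.CategoryStruct.id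 _) Y → (∀ (X' X'' : AlgebraicGeometry.Scheme.{0}) (σ' : X' ⟶ (AlgebraicGeometry.Proj (MvPolynomial.homogeneousSubmodule (Fin (n + 1)) O))) (Y' : Set X') (C : X'.IdealSheafData) (τ : X'' ⟶ X'), Q X' σ' Y' → Literature.AlgebraicGeometry.Resolution.IsBlowup τ C → Literature.AlgebraicGeometry.Resolution.Scheme.IsRegular C.subscheme → AlgebraicGeometry.Flat (CategoryTheory.CategoryStruct.comp C.subschemeι (CategoryTheory.CategoryStruct.comp σ' (CategoryTheory.CategoryStruct.comp (AlgebraicGeometry.Proj.toSpecZero (MvPolynomial.homogeneousSubmodule (Fin (n + 1)) O)) (AlgebraicGeometry.Spec.map (CommRingCat.ofHom (algebraMap O (MvPolynomial.homogeneousSubmodule (Fin (n + 1)) O 0))))))) → σ' '' (C.support : Set X') ⊆ {x | ¬ IsGenericPoint x Y} → (C.support : Set X') ∩ (CategoryTheory.CategoryStruct.comp σ' (CategoryTheory.CategoryStruct.comp (AlgebraicGeometry.Proj.toSpecZero (MvPolynomial.homogeneousSubmodule (Fin (n + 1)) O)) (AlgebraicGeometry.Spec.map (CommRingCat.ofHom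 (algebraMap O (MvPolynomial.homogeneousSubmodule (Fin (n + 1)) O 0)))))) ⁻¹' {IsLocalRing.closedPoint O} ⊆ Y' → ((CategoryTheory.CategoryStruct.comp ι (AlgebraicGeometry.Proj.map φ hφ') : H ⟶ (AlgebraicGeometry.Proj (MvPolynomial.homogeneousSubmodule (Fin (n + 1)) O))) h) ∉ σ' '' (C.support : Set X') → Q X'' (CategoryTheory.CategoryStruct.comp τ σ') (closure (τ ⁻¹' (Y' \ (C.support : Set X'))))) → Q P' σ S') ∧ ∃ C : P'.IdealSheafData, Literature.AlgebraicGeometry.Resolution.Scheme.IsRegular C.subscheme ∧ AlgebraicGeometry.Flat (CategoryTheory.CategoryStruct.comp C.subschemeι (CategoryTheory.CategoryStruct.comp σ (CategoryTheory.CategoryStruct.comp (AlgebraicGeometry.Proj.toSpecZero (MvPolynomial.homogeneousSubmodule (Fin (n + 1)) O)) (AlgebraicGeometry.Spec.map (CommRingCat.ofHom (algebraMap O (MvPolynomial.homogeneousSubmodule (Fin (n + 1)) O 0))))))) ∧ (∃ x' : P', x' ∈ (C.support : Set P') ∧ σ x' = ((CategoryTheory.CategoryStruct.comp ι (AlgebraicGeometry.Proj.map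 φ hφ') : H ⟶ (AlgebraicGeometry.Proj (MvPolynomial.homogeneousSubmodule (Fin (n + 1)) O))) h) ∧ ∃ c : P', c ∈ (C.support : Set P') ∧ c ∉ (CategoryTheory.CategoryStruct.comp σ (CategoryTheory.CategoryStruct.comp (AlgebraicGeometry.Proj.toSpecZero (MvPolynomial.homogeneousSubmodule (Fin (n + 1)) O)) (AlgebraicGeometry.Spec.map (CommRingCat.ofHom (algebraMap O (MvPolynomial.homogeneousSubmodule (Fin (n + 1)) O 0)))))) ⁻¹' {IsLocalRing.closedPoint O} ∧ c ⤳ x') ∧ (C.support : Set P') ∩ (CategoryTheory.CategoryStruct.comp σ (CategoryTheory.CategoryStruct.comp (AlgebraicGeometry.Proj.toSpecZero (MvPolynomial.homogeneousSubmodule (Fin (n + 1)) O)) (AlgebraicGeometry.Spec.map (CommRingCat.ofHom (algebraMap O (MvPolynomial.homogeneousSubmodule (Fin (n + 1)) O 0)))))) ⁻¹' {IsLocalRing.closedPoint O} ⊆ closure S' ∧ σ '' (C.support : Set P') ⊆ {x | ¬ IsGenericPoint x Y}) := by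
  intro hp k _ _ _ n H ι hι hH hloc h hreg
  obtain ⟨O, i1, i2, i3, i4, π, hπ, h'⟩ := hE hp k n H ι hι hH hloc
  refine ⟨O, i1, i2, i3, i4, π, hπ, ?_⟩
  letI := MvPolynomial.gradedAlgebra (σ := Fin (n + 1)) (R := O)
  letI := MvPolynomial.gradedAlgebra (σ := Fin (n + 1)) (R := k)
  intro φ hφ' hφ Y hY
  haveI := hH
  obtain ⟨P', σ, S', hchain, hirr, hregS⟩ := h' φ hφ' hφ Y hY
  -- the base `q : ℙⁿ_O → Spec O`
  set q : Proj (MvPolynomial.homogeneousSubmodule (Fin (n + 1)) O) ⟶ Spec (.of O) :=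
    Proj.toSpecZero (MvPolynomial.homogeneousSubmodule (Fin (n + 1)) O) ≫
      Spec.map (CommRingCat.ofHom (algebraMap O (MvPolynomial.homogeneousSubmodule (Fin (n + 1)) O 0))) with hq
  obtain ⟨hsm, hprop⟩ := stub_projectiveAmbientSmoothProper O n
  haveI : IsProper q := hprop
  haveI : Smooth q := hsm
  haveI : IsNoetherianRing (CommRingCat.of O) := inferInstanceAs (IsNoetherianRing O)
  haveI : IsDomain (CommRingCat.of O) := inferInstanceAs (IsDomain O)
  haveI : IsLocallyNoetherian (Proj (MvPolynomial.homogeneousSubmodule (Fin (n + 1)) O)) :=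
    LocallyOfFiniteType.isLocallyNoetherian q
  haveI : CompactSpace ↥(Proj (MvPolynomial.homogeneousSubmodule (Fin (n + 1)) O)) :=
    QuasiCompact.compactSpace_of_compactSpace q
  haveI : IsIntegral (Proj (MvPolynomial.homogeneousSubmodule (Fin (n + 1)) O)) :=
    Proj.isIntegral _ (irrelevant_homogeneousSubmodule_ne_bot n O)
  -- the comparison `g : ℙⁿ_k → ℙⁿ_O`, a closed immersion onto the special fibre
  set g : Proj (MvPolynomial.homogeneousSubmodule (Fin (n + 1)) k) ⟶
      Proj (MvPolynomial.homogeneousSubmodule (Fin (n + 1)) O) := Proj.map φ hφ' with hg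
  have hP := ProjectiveAmbientFibre.isPullback_projMap π φ hφ hπ hφ'
  haveI : IsClosedImmersion (Spec.map (CommRingCat.ofHom π)) := IsClosedImmersion.spec_of_surjective _ hπ
  haveI hgci : IsClosedImmersion g := MorphismProperty.IsStableUnderBaseChange.of_isPullback hP.flip inferInstance
  have hpt : ∀ z : Spec (.of k), Spec.map (CommRingCat.ofHom π) z = IsLocalRing.closedPoint O := by
    intro z
    rw [Spec.map_apply]
    apply PrimeSpectrum.ext
    rw [PrimeSpectrum.comap_asIdeal, CommRingCat.hom_ofHom, Ideal.eq_bot_of_prime z.asIdeal, ← RingHom.ker_eq_comap_bot]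
    exact IsLocalRing.eq_maximalIdeal (RingHom.ker_isMaximal_of_surjective π hπ)
  have hgq : ∀ z, q (g z) = IsLocalRing.closedPoint O := fun z ↦
    (Scheme.Hom.comp_apply g q z).symm.trans
      ((congrArg (fun h : Proj (MvPolynomial.homogeneousSubmodule (Fin (n + 1)) k) ⟶ Spec (.of O) ↦ h z) hP.w).trans
        ((Scheme.Hom.comp_apply _ _ z).trans (hpt _)))
  -- `ι` as a closed immersion into `Proj k[x]`
  let ι' : H ⟶ Proj (MvPolynomial.homogeneousSubmodule (Fin (n + 1)) k) := ι
  haveI : IsClosedImmersion ι' := hι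
  have hYF : Y ⊆ q ⁻¹' {IsLocalRing.closedPoint O} := by
    rw [hY]
    rintro _ ⟨a, rfl⟩
    show q ((ι ≫ g) a) = IsLocalRing.closedPoint O
    rw [Scheme.Hom.comp_apply]
    exact hgq (ι a)
  have hYcl : IsClosed Y := by rw [hY]; exact (ι' ≫ g).isClosedEmbedding.isClosed_range
  -- a point of `ℙⁿ_k` outside `range ι` (else `H ≅ ℙⁿ_k` would be regular at `h`)
  have hH' : ∃ z : Proj (MvPolynomial.homogeneousSubmodule (Fin (n + 1)) k), z ∉ Set.range ι' := by
    by_contra hall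
    push Not at hall
    have hrange : Set.range (𝟙 (Proj (MvPolynomial.homogeneousSubmodule (Fin (n + 1)) k))) = Set.range ι' := by
      ext z; simpa using hall z
    haveI : IsIntegral (Proj (MvPolynomial.homogeneousSubmodule (Fin (n + 1)) k)) :=
      isIntegral_proj_homogeneousSubmodule n k
    have hregP : IsRegularLocalRing ((Proj (MvPolynomial.homogeneousSubmodule (Fin (n + 1)) k)).presheaf.stalk (ι' h)) :=
      isRegular_projectiveSpace n k (ι' h)
    exact hreg ((isRegularLocalRing_stalk_iff_of_range_eq (𝟙 _) ι' hrange (a₁ := ι' h) (a₂ := h) (by simp)).mpr hregP)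
  -- no maximal point of the (irreducible) special fibre lies in `closure Y = Y`
  have hirrP : IsIrreducible (q ⁻¹' {IsLocalRing.closedPoint O}) := by
    haveI := isIntegral_specialFibre_projectiveSpace O n
    exact isIrreducible_preimage_closedPoint O _ q
  have hNM : ∀ w, (w ∈ q ⁻¹' {IsLocalRing.closedPoint O} ∧
      ∀ y ∈ q ⁻¹' {IsLocalRing.closedPoint O}, y ⤳ w → y = w) → w ∉ closure Y := by
    intro w hw hwY
    obtain ⟨ζ, hζ⟩ := QuasiSober.sober hirrP
      ((IsLocalRing.isClosed_singleton_closedPoint O).preimage q.base.hom.continuous)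
    have hζw : ζ = w := hw.2 ζ hζ.mem (hζ.specializes hw.1)
    rw [hYcl.closure_eq] at hwY
    have hFY : q ⁻¹' {IsLocalRing.closedPoint O} ⊆ Y := by
      rw [← hζ.def, hζw]
      exact closure_minimal (Set.singleton_subset_iff.mpr hwY) hYcl
    obtain ⟨z, hz⟩ := hH'
    have hgz : g z ∈ Y := hFY (hgq z)
    rw [hY] at hgz
    obtain ⟨a, ha⟩ := hgz
    rw [Scheme.Hom.comp_apply] at ha
    exact hz ⟨a, g.isClosedEmbedding.injective ha⟩
  -- the generic point of `ℙⁿ_O` is off the special fibre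
  have hgenP : ∀ ξ : Proj (MvPolynomial.homogeneousSubmodule (Fin (n + 1)) O),
      IsGenericPoint ξ (Set.univ : Set (Proj (MvPolynomial.homogeneousSubmodule (Fin (n + 1)) O))) →
        ξ ∉ q ⁻¹' {IsLocalRing.closedPoint O} := by
    intro ξ hξ hξF
    have hopen : IsOpen (Set.range q) := by
      rw [← Set.image_univ]; exact q.isOpenMap _ isOpen_univ
    have hne : (Set.range q).Nonempty := ⟨q ξ, ξ, rfl⟩
    have hgen : genericPoint (Spec (.of O)) ∈ Set.range q := by
      rw [(genericPoint_spec (Spec (.of O))).mem_open_set_iff hopen]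
      simpa using hne
    obtain ⟨p₀, hp₀⟩ := hgen
    have hp₀F : p₀ ∈ q ⁻¹' {IsLocalRing.closedPoint O} := by
      have hF : q ⁻¹' {IsLocalRing.closedPoint O} = Set.univ := by
        apply Set.eq_univ_of_univ_subset
        rw [← hξ.def]
        exact closure_minimal (Set.singleton_subset_iff.mpr hξF)
          ((IsLocalRing.isClosed_singleton_closedPoint O).preimage q.base.hom.continuous)
      rw [hF]; trivial
    have h1 : genericPoint (Spec (.of O)) = IsLocalRing.closedPoint O := hp₀.symm.trans hp₀F
    rw [genericPoint_eq_bot_of_affine] at h1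
    have h2 := congrArg PrimeSpectrum.asIdeal h1
    exact IsDiscreteValuationRing.not_a_field O h2.symm
  -- the non-regular point of `V(closure Y)` over `x := (ι ≫ g) h` (pv-003's bridge)
  have hci := @IsClosedImmersion.comp _ _ _ ι _ hι hgci
  have hx := @exists_vanishingIdeal_witness_of_not_isRegularLocalRing _ _ _ hci inferInstance _ hreg
  subst hY
  obtain ⟨X₀, σ₀, Y₀, hav, C₀, hC, hflat, hpt', hE1, hgen⟩ :=
    exists_flat_touching_centre_of_natChain q _ σ S' hchain hirr hregS hgenP hYF hNM ⟨h, rfl⟩ hx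
  exact ⟨X₀, σ₀, Y₀, hav, C₀, hC, hflat, hpt', hE1.trans subset_closure, hgen⟩

/-- **The disprover's exit in the flat currency.** ONE instance `(k, n, H, ι, h)` with `𝒪_{H,h}` not regular for which, for
EVERY characteristic-0 DVR `O` with a surjection `π : O → k`, some `φ, Y` admit NO horizontally reached stage with an
`O`-flat regular E1 non-generic centre through a point over `x` (the negation of the body above) refutes `EquisingularLiftNat p`.
[folklore] -/
theorem not_equisingularLiftNat_of_not_ultFlat {p : ℕ}
    (hno : ¬ (p.Prime → ∀ (k : Type) [Field k] [CharP k p] [IsAlgClosed k] (n : ℕ) (H : AlgebraicGeometry.Scheme.{0}) (ι : H ⟶ (Literature.AlgebraicGeometry.Motives.projectiveSpace n k).left), AlgebraicGeometry.IsClosedImmersion ι → AlgebraicGeometry.IsIntegral H → (∀ y : (Literature.AlgebraicGeometry.Motives.projectiveSpace n k).left, ∃ U : (Literature.AlgebraicGeometry.Motives.projectiveSpace n k).left.affineOpens, y ∈ (U : (Literature.AlgebraicGeometry.Motives.projectiveSpace n k).left.Opens) ∧ (ι.ker.ideal U).IsPrincipal) → ∀ (h : H), ¬ IsRegularLocalRing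 (H.presheaf.stalk h) → ∃ (O : Type) (_ : CommRing O) (_ : IsDomain O) (_ : IsDiscreteValuationRing O) (_ : CharZero O) (π : O →+* k), Function.Surjective π ∧ (letI := MvPolynomial.gradedAlgebra (σ := Fin (n + 1)) (R := O); letI := MvPolynomial.gradedAlgebra (σ := Fin (n + 1)) (R := k); ∀ (φ : MvPolynomial.homogeneousSubmodule (Fin (n + 1)) O →+*ᵍ MvPolynomial.homogeneousSubmodule (Fin (n + 1)) k) (hφ' : HomogeneousIdeal.irrelevant (MvPolynomial.homogeneousSubmodule (Fin (n + 1)) k) ≤ (HomogeneousIdeal.irrelevant (MvPolynomial.homogeneousSubmodule (Fin (n + 1)) O)).map φ), (∀ s, φ s = MvPolynomial.map π s) → ∀ Y : Set (AlgebraicGeometry.Proj (MvPolynomial.homogeneousSubmodule (Fin (n + 1)) O)), Y = Set.range (CategoryTheory.CategoryStruct.comp ι (AlgebraicGeometry.Proj.map φ hφ') : H ⟶ (AlgebraicGeometry.Proj (MvPolynomial.homogeneousSubmodule (Fin (n + 1)) O))) → ∃ (P' : AlgebraicGeometry.Scheme.{0}) (σ : P' ⟶ (AlgebraicGeometry.Proj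 (MvPolynomial.homogeneousSubmodule (Fin (n + 1)) O))) (S' : Set P'), (∀ Q : (∀ X' : AlgebraicGeometry.Scheme.{0}, (X' ⟶ (AlgebraicGeometry.Proj (MvPolynomial.homogeneousSubmodule (Fin (n + 1)) O))) → Set X' → Prop), Q (AlgebraicGeometry.Proj (MvPolynomial.homogeneousSubmodule (Fin (n + 1)) O)) (CategoryTheory.CategoryStruct.id _) Y → (∀ (X' X'' : AlgebraicGeometry.Scheme.{0}) (σ' : X' ⟶ (AlgebraicGeometry.Proj (MvPolynomial.homogeneousSubmodule (Fin (n + 1)) O))) (Y' : Set X') (C : X'.IdealSheafData) (τ : X'' ⟶ X'), Q X' σ' Y' → Literature.AlgebraicGeometry.Resolution.IsBlowup τ C → Literature.AlgebraicGeometry.Resolution.Scheme.IsRegular C.subscheme → AlgebraicGeometry.Flat (CategoryTheory.CategoryStruct.comp C.subschemeι (CategoryTheory.CategoryStruct.comp σ' (CategoryTheory.CategoryStruct.comp (AlgebraicGeometry.Proj.toSpecZero (MvPolynomial.homogeneousSubmodule (Fin (n + 1)) O)) (AlgebraicGeometry.Spec.map (CommRingCat.ofHom (algebraMap O (MvPolynomial.homogeneousSubmodule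 (Fin (n + 1)) O 0))))))) → σ' '' (C.support : Set X') ⊆ {x | ¬ IsGenericPoint x Y} → (C.support : Set X') ∩ (CategoryTheory.CategoryStruct.comp σ' (CategoryTheory.CategoryStruct.comp (AlgebraicGeometry.Proj.toSpecZero (MvPolynomial.homogeneousSubmodule (Fin (n + 1)) O)) (AlgebraicGeometry.Spec.map (CommRingCat.ofHom (algebraMap O (MvPolynomial.homogeneousSubmodule (Fin (n + 1)) O 0)))))) ⁻¹' {IsLocalRing.closedPoint O} ⊆ Y' → ((CategoryTheory.CategoryStruct.comp ι (AlgebraicGeometry.Proj.map φ hφ') : H ⟶ (AlgebraicGeometry.Proj (MvPolynomial.homogeneousSubmodule (Fin (n + 1)) O))) h) ∉ σ' '' (C.support : Set X') → Q X'' (CategoryTheory.CategoryStruct.comp τ σ') (closure (τ ⁻¹' (Y' \ (C.support : Set X'))))) → Q P' σ S') ∧ ∃ C : P'.IdealSheafData, Literature.AlgebraicGeometry.Resolution.Scheme.IsRegular C.subscheme ∧ AlgebraicGeometry.Flat (CategoryTheory.CategoryStruct.comp C.subschemeι (CategoryTheory.CategoryStruct.comp σ (CategoryTheory.CategoryStruct.comp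 (AlgebraicGeometry.Proj.toSpecZero (MvPolynomial.homogeneousSubmodule (Fin (n + 1)) O)) (AlgebraicGeometry.Spec.map (CommRingCat.ofHom (algebraMap O (MvPolynomial.homogeneousSubmodule (Fin (n + 1)) O 0))))))) ∧ (∃ x' : P', x' ∈ (C.support : Set P') ∧ σ x' = ((CategoryTheory.CategoryStruct.comp ι (AlgebraicGeometry.Proj.map φ hφ') : H ⟶ (AlgebraicGeometry.Proj (MvPolynomial.homogeneousSubmodule (Fin (n + 1)) O))) h) ∧ ∃ c : P', c ∈ (C.support : Set P') ∧ c ∉ (CategoryTheory.CategoryStruct.comp σ (CategoryTheory.CategoryStruct.comp (AlgebraicGeometry.Proj.toSpecZero (MvPolynomial.homogeneousSubmodule (Fin (n + 1)) O)) (AlgebraicGeometry.Spec.map (CommRingCat.ofHom (algebraMap O (MvPolynomial.homogeneousSubmodule (Fin (n + 1)) O 0)))))) ⁻¹' {IsLocalRing.closedPoint O} ∧ c ⤳ x') ∧ (C.support : Set P') ∩ (CategoryTheory.CategoryStruct.comp σ (CategoryTheory.CategoryStruct.comp (AlgebraicGeometry.Proj.toSpecZero (MvPolynomial.homogeneousSubmodule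 (Fin (n + 1)) O)) (AlgebraicGeometry.Spec.map (CommRingCat.ofHom (algebraMap O (MvPolynomial.homogeneousSubmodule (Fin (n + 1)) O 0)))))) ⁻¹' {IsLocalRing.closedPoint O} ⊆ closure S' ∧ σ '' (C.support : Set P') ⊆ {x | ¬ IsGenericPoint x Y}))) :
    ¬ Summit.ResolutionOfSingularities.ResolutionOfSingularities.Theorems.EquisingularLiftNat p :=
  fun hE => hno (ultFlat_of_equisingularLiftNat hE)

end Summit.ResolutionOfSingularities.ResolutionOfSingularities.Cruxes.EquisingularLiftNat.Sections
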